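import Literature.NumberTheory.EllipticCurves.ModularSymbolsManin
import Mathlib.LinearAlgebra.Matrix.GeneralLinearGroup.FinTwo

/-!
# The parabolic cohomology `H¹_P(Γ₀(N), ℝ)` and the Eichler–Shimura lattice property
# (`ModularSymbols`, `ModularSymbolsLattice`, `ModularSymbolsPeriodHomology`, `ModularSymbolsManin`,
# continued)

For a weight-`2` cusp form `h ∈ S₂(Γ₀(N))` write `{∞, γ∞}_h` (`cuspSymbol h γ`, `γ ∈ Γ₀(N)`) for its
periods, `Λ_f = ⟨{∞, γ∞}_f⟩` (`periodLattice f`) and `H ⊆ S₂(Γ₀(N))^∧` for the period homology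
(`periodHomology N`, the group of the period functionals `h ↦ {∞, γ∞}_h`, i.e. the image of
`H₁(X₀(N), ℤ)` in the dual space). `ModularSymbolsPeriodHomology` reduces the Eichler–Shimura
lattice property `isZLattice_periodLattice` of `ModularSymbols` (for a rational newform `f`, `Λ_f`
is a lattice in `ℂ`; Shimura 1971, Thm. 7.14; Knapp 1993, Thm. 11.74(d)) to the rank statement
`periodHomology_eq_span_fin_two_mul_finrank N` ("`H` is generated by `2 dim_ℂ S₂(Γ₀(N))`
elements"), and `ModularSymbolsManin` proves Manin's bound `rank H ≤ 2g(X₀(N))`, leaving only the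
existence of `g(X₀(N))` independent weight-`2` cusp forms (`twelve_mul_finrank_cuspForm_two`,
Riemann–Roch). This file records the *cohomological* form of the same circle of ideas — Shimura's
Chapter 8 — and reduces the rank statement to the dimension count in the Eichler–Shimura
isomorphism `S₂(Γ) ≅ H¹_P(Γ, ℝ)` (Shimura 1971, Thm. 8.4, (8.2.23)), proving its injectivity half:

* `parabolicCocycles N` (**definition**): the real vector space `Z¹_P(Γ₀(N), ℝ)` of *parabolic
  cocycles* of `Γ₀(N)` with trivial real coefficients — maps `u : Γ₀(N) → ℝ` with
  `u(γδ) = u(γ) + u(δ)` (Shimura (8.1.1) for the trivial module `X = ℝ`) and `u(π) = 0` for every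
  parabolic `π ∈ Γ₀(N)` (Shimura (8.1.4): `u(π) ∈ (π - 1)X = 0`). Since the coboundaries
  `v(α) = (α - 1)x` vanish for trivial coefficients, this *is* the parabolic cohomology group
  `H¹_P(Γ₀(N), X)` of Shimura §8.1–8.2 for `n = 0`, `Ψ` trivial (`X = X₀^Ψ = ℝ`). Parabolic means
  Mathlib's `Matrix.IsParabolic` (non-scalar with vanishing discriminant `tr² - 4 det`, i.e.
  `γ ≠ ±1`, `tr(γ)² = 4`). It is finite-dimensional (`finiteDimensional_parabolicCocycles`:
  `Γ₀(N)` is finitely generated).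
* `cuspSymbol_eq_zero_of_isParabolic`, `periodFunctional_eq_zero_of_isParabolic` (proved): **the
  periods of a parabolic element vanish**, `{∞, π∞}_h = 0` (Knapp 1993, Prop. 11.1; Shimura 1971,
  §8.2, p. 233: "`t ∈ Z¹_P(Γ, X_c)`"): a parabolic `π = (a b; c d)`, `c ≠ 0`, fixes the rational
  cusp `r = (a - d)/(2c)`, and Manin's relation `{∞, πr} = {∞, π∞} + {∞, r}`
  (`modularSymbol_gamma0_smul_holds`) with `πr = r` gives `{∞, π∞} = 0`; if `c = 0` the period is
  `0` by definition. Hence the coordinates of the period map `γ ↦ (h ↦ {∞, γ∞}_h) ∈ H ≅ ℤ^r` in a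
  `ℤ`-basis of the (finitely generated, torsion-free, hence free) group `H` are `r` linearly
  independent parabolic cocycles (`exists_periodHomology_eq_span_card_le`), so that
  (`two_mul_finrank_le_finrank_parabolicCocycles`, proved)
  **`2 dim_ℂ S₂(Γ₀(N)) ≤ rank H ≤ dim_ℝ H¹_P(Γ₀(N), ℝ)`** — the first inequality because `H` spans
  the `2 dim_ℂ S₂`-dimensional real space `S₂^∧` (`periodHomology_span_eq_top`); this is the
  injectivity half of Shimura's Thm. 8.4 in dimension form (Knapp 1993, Prop. 11.22:
  `H₁(X₀(N), ℤ) ≅ Γ₀(N)ᵃᵇ/Γ_epᵃᵇ`, so `Hom(H, ℝ) ↪ H¹_P(Γ₀(N), ℝ)`).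
* `finrank_parabolicCocycles_eq N` (**named fact**, Shimura 1971, §8.2, (8.2.23), the case
  `n = 0`, `Ψ` trivial, `Γ = Γ₀(N)`): **`dim_ℝ H¹_P(Γ₀(N), ℝ) = 2 dim_ℂ S₂(Γ₀(N))`**. By the above
  only `≤` is open; Shimura proves it ((8.2.24), from Prop. 8.2, 8.3: an Euler-characteristic
  count on a fundamental domain) as `dim H¹_P(Γ, X) = 2g` with `g` the genus of `Γ\ℍ*`, together
  with `dim S₂(Γ) = g` (Thm. 2.24, Riemann–Roch; cf. the named facts
  `finrank_cuspForm_two_eq_genusX0` of `ModularCurve`, `twelve_mul_finrank_cuspForm_two` of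
  `ModularCurveProofs`), which is not available at the Mathlib pin.
* `periodHomology_eq_span_fin_two_mul_finrank_of_parabolicCocycles` (proved): the named fact
  implies `rank H ≤ 2 dim_ℂ S₂(Γ₀(N))`, i.e. `periodHomology_eq_span_fin_two_mul_finrank N`; hence
  (`isZLattice_periodLattice_of_parabolicCocycles`, with `isZLattice_periodLattice_of_periodHomology`
  of `ModularSymbolsPeriodHomology`) **the Eichler–Shimura lattice property
  `isZLattice_periodLattice` for every rational newform of level `N` follows from Shimura's
  (8.2.23) for `Γ₀(N)`**, and so do `Ω^±_f > 0` (`IsNewform0.plusPeriod_pos_of_parabolicCocycles`,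
  `IsNewform0.minusPeriod_pos_of_parabolicCocycles`, given the conjugation-stability fact
  `conj_mem_periodLattice` of `ModularSymbols`).

## The two routes to `isZLattice_periodLattice` in the tree

`isZLattice_periodLattice (f)` ⟸ `periodHomology_eq_span_basis N` ⟺
`periodHomology_eq_span_fin_two_mul_finrank N` (`ModularSymbolsPeriodHomology`), and the latter
follows either from `twelve_mul_finrank_cuspForm_two (Gamma0 N)` (Manin's M-symbol rank bound,
`ModularSymbolsManin`; only the lower bound `g(X₀(N)) ≤ dim S₂(Γ₀(N))` of that fact is open,
`ModularCurveGenusIntegralityProofs`) or from `finrank_parabolicCocycles_eq N` (this file;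
only `dim H¹_P ≤ 2 dim S₂` is open). Both open halves contain the same analytic input, the
existence of `g(X₀(N))` independent weight-`2` cusp forms (Riemann–Roch on `X₀(N)`, Shimura
Thm. 2.24), the cohomological route in addition the completeness of the parabolic/elliptic
relations (`dim H¹_P(Γ₀(N), ℝ) = 2g(X₀(N))`, Shimura (8.2.24), Prop. 8.2–8.3; Manin 1972, Thm. 1.9).

## References

* G. Shimura, *Introduction to the arithmetic theory of automorphic functions*, Iwanami Shoten and
  Princeton University Press, 1971: §1.2 (parabolic elements), §8.1 ((8.1.1), (8.1.2), (8.1.4),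
  Prop. 8.2, Prop. 8.3, (8.1.30)), §8.2 (Thm. 8.4, (8.2.19)–(8.2.24)), Thm. 2.24, Thm. 7.14.
* A. W. Knapp, *Elliptic curves*, Mathematical Notes 40, Princeton University Press, 1993:
  Prop. 11.1, Prop. 11.22, (11.37), Thm. 11.74(d).
* Ju. I. Manin, *Parabolic points and zeta functions of modular curves*, Izv. Akad. Nauk SSSR 36
  (1972), Thm. 1.9.
* J. E. Cremona, *Algorithms for modular elliptic curves*, 2nd ed., CUP 1997, §2.1, §2.6, §2.10.
-/

noncomputable section

open scoped MatrixGroups ModularForm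

open CongruenceSubgroup

namespace Literature.NumberTheory.EllipticCurves.ModularForms

/-! ### Periods of parabolic elements vanish -/

section ParabolicVanishing

variable {N : ℕ} [NeZero N]

/-- **The period over a parabolic element vanishes** (trace form): if `γ = (a b; c d) ∈ Γ₀(N)` has
`tr(γ)² = 4 det(γ) = 4` (vanishing discriminant), then `{∞, γ∞}_h = 0` for every
`h ∈ S₂(Γ₀(N))`. For `c = 0` this is the definition of `cuspSymbol`; for `c ≠ 0`, `γ` fixes the
rational cusp `r = (a - d)/(2c)` (`cr + d = (a + d)/2 = ±1 ≠ 0`), and Manin's relation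
`{∞, γr}_h = {∞, γ∞}_h + {∞, r}_h` (`modularSymbol_gamma0_smul_holds`) with `γr = r` gives
`{∞, γ∞}_h = 0` (Knapp 1993, Prop. 11.1: "`Φ_f(γ₀) = 0` for `γ₀` parabolic"; Shimura 1971, §8.2,
p. 233). [cite: Knapp1993, Prop. 11.1] -/
theorem cuspSymbol_eq_zero_of_discr_eq_zero (h : CuspForm (Gamma0 N) 2) {γ : Gamma0 N}
    (hγ : ((γ : SL(2, ℤ)) : Matrix (Fin 2) (Fin 2) ℤ).discr = 0) : cuspSymbol h γ = 0 := by
  have hdet : (γ : SL(2, ℤ)) 0 0 * (γ : SL(2, ℤ)) 1 1 - (γ : SL(2, ℤ)) 0 1 * (γ : SL(2, ℤ)) 1 0 = 1 := by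
    have := Matrix.SpecialLinearGroup.det_coe (γ : SL(2, ℤ))
    rwa [Matrix.det_fin_two] at this
  have htr : ((γ : SL(2, ℤ)) 0 0 + (γ : SL(2, ℤ)) 1 1) ^ 2 = 4 := by
    rw [Matrix.discr_fin_two, Matrix.trace_fin_two, Matrix.SpecialLinearGroup.det_coe] at hγ
    linear_combination hγ
  by_cases hc : (γ : SL(2, ℤ)) 1 0 = 0
  · simp [cuspSymbol, hc]
  · -- the rational fixed point `r = (a - d) / (2c)` of `γ`
    set a : ℚ := ((γ : SL(2, ℤ)) 0 0 : ℚ) with ha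
    set b : ℚ := ((γ : SL(2, ℤ)) 0 1 : ℚ) with hb
    set c : ℚ := ((γ : SL(2, ℤ)) 1 0 : ℚ) with hc'
    set d : ℚ := ((γ : SL(2, ℤ)) 1 1 : ℚ) with hd
    have hdet' : a * d - b * c = 1 := by
      rw [ha, hb, hc', hd]; exact_mod_cast hdet
    have htr' : (a + d) ^ 2 = 4 := by
      rw [ha, hd]; exact_mod_cast htr
    have hc0 : c ≠ 0 := by rw [hc']; exact_mod_cast hc
    have had : a + d ≠ 0 := by
      intro h0; rw [h0] at htr'; norm_num at htr'
    set r : ℚ := (a - d) / (2 * c) with hr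
    have hcr : c * r = (a - d) / 2 := by
      rw [hr]; field_simp
    have hden : c * r + d = (a + d) / 2 := by rw [hcr]; ring
    have hden0 : c * r + d ≠ 0 := by
      rw [hden]; exact div_ne_zero had two_ne_zero
    have hfix : (a * r + b) / (c * r + d) = r := by
      rw [div_eq_iff hden0, hden, hr]
      field_simp
      linear_combination (-4 : ℚ) * hdet' + htr'
    have H := modularSymbol_gamma0_smul_holds h γ r hden0
    rw [hfix] at H
    linear_combination -H

/-- **The period over a parabolic element vanishes**: `{∞, π∞}_h = 0` for every parabolic
`π ∈ Γ₀(N)` (`π ≠ ±1`, `tr(π)² = 4`; Mathlib `Matrix.IsParabolic`) and every `h ∈ S₂(Γ₀(N))`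
(Knapp 1993, Prop. 11.1; Shimura 1971, §8.2, p. 233: the period cocycle `t` of a cusp form lies in
`Z¹_P(Γ, X_c)`). [cite: Knapp1993, Prop. 11.1] -/
theorem cuspSymbol_eq_zero_of_isParabolic (h : CuspForm (Gamma0 N) 2) {γ : Gamma0 N}
    (hγ : ((γ : SL(2, ℤ)) : Matrix (Fin 2) (Fin 2) ℤ).IsParabolic) : cuspSymbol h γ = 0 :=
  cuspSymbol_eq_zero_of_discr_eq_zero h hγ.2

/-- The period functional `h ↦ {∞, π∞}_h` of a parabolic `π ∈ Γ₀(N)` is zero (Knapp 1993,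
Prop. 11.1; Shimura 1971, §8.2, p. 233). [cite: Knapp1993, Prop. 11.1] -/
theorem periodFunctional_eq_zero_of_isParabolic {γ : Gamma0 N}
    (hγ : ((γ : SL(2, ℤ)) : Matrix (Fin 2) (Fin 2) ℤ).IsParabolic) : periodFunctional N γ = 0 := by
  ext h
  exact cuspSymbol_eq_zero_of_isParabolic h hγ

end ParabolicVanishing

/-! ### The parabolic cohomology `H¹_P(Γ₀(N), ℝ) = Z¹_P(Γ₀(N), ℝ)` -/

section ParabolicCocycles

variable (N : ℕ)

/-- **The parabolic cohomology `H¹_P(Γ₀(N), ℝ)` of `Γ₀(N)` with trivial real coefficients**,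
realised as the real vector space `Z¹_P(Γ₀(N), ℝ)` of *parabolic cocycles*: functions
`u : Γ₀(N) → ℝ` with `u(γδ) = u(γ) + u(δ)` (the cocycle identity `u(αβ) = u(α) + α u(β)` of
Shimura (8.1.1) for the trivial `Γ₀(N)`-module `X = ℝ`) and `u(π) = 0` for every parabolic
`π ∈ Γ₀(N)` (the parabolic condition `u(π) ∈ (π - 1)X` of Shimura (8.1.4), `(π - 1)X = 0`), where
parabolic (Shimura §1.2: `π ≠ ±1`, `tr(π)² = 4`) is Mathlib's `Matrix.IsParabolic` (non-scalar,
discriminant `tr² - 4 det = 0`) for the integral matrix of `π`. For trivial coefficients the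
coboundaries `v(α) = (α - 1)x_v` (Shimura (8.1.2)) are zero, so `Z¹_P = Z¹_P/B¹ = H¹_P(Γ₀(N), X)`,
the group of Shimura 1971, §8.1–§8.2 in the case `n = 0`, `Ψ` trivial (`X = X₀^Ψ = ℝ`), which
Thm. 8.4 there identifies with `S₂(Γ₀(N))` as a real vector space. [cite: ShimuraIATAF1971, §8.1 (8.1.1), (8.1.4); §8.2] -/
def parabolicCocycles : Submodule ℝ (Gamma0 N → ℝ) where
  carrier := {u | (∀ γ δ : Gamma0 N, u (γ * δ) = u γ + u δ) ∧
    ∀ γ : Gamma0 N, ((γ : SL(2, ℤ)) : Matrix (Fin 2) (Fin 2) ℤ).IsParabolic → u γ = 0}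
  add_mem' := by
    rintro u v ⟨hu, hu'⟩ ⟨hv, hv'⟩
    refine ⟨fun γ δ ↦ ?_, fun γ hγ ↦ ?_⟩
    · simp only [Pi.add_apply, hu, hv]; ring
    · simp [hu' γ hγ, hv' γ hγ]
  zero_mem' := ⟨fun _ _ ↦ by simp, fun _ _ ↦ rfl⟩
  smul_mem' := by
    rintro c u ⟨hu, hu'⟩
    refine ⟨fun γ δ ↦ ?_, fun γ hγ ↦ ?_⟩
    · simp only [Pi.smul_apply, hu, smul_eq_mul]; ring
    · simp [hu' γ hγ]

variable {N}

/-- Unfolding `parabolicCocycles`: membership is the cocycle identity plus vanishing on parabolic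
elements. [folklore] -/
theorem mem_parabolicCocycles_iff {u : Gamma0 N → ℝ} :
    u ∈ parabolicCocycles N ↔ (∀ γ δ : Gamma0 N, u (γ * δ) = u γ + u δ) ∧
      ∀ γ : Gamma0 N, ((γ : SL(2, ℤ)) : Matrix (Fin 2) (Fin 2) ℤ).IsParabolic → u γ = 0 :=
  Iff.rfl

/-- A cocycle with trivial coefficients is a homomorphism `Γ₀(N) → ℝ` (written multiplicatively
for Mathlib's `MonoidHom`). [folklore] -/
def cocycleHom (u : Gamma0 N → ℝ) (hu : ∀ γ δ : Gamma0 N, u (γ * δ) = u γ + u δ) :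
    Gamma0 N →* Multiplicative ℝ where
  toFun γ := Multiplicative.ofAdd (u γ)
  map_one' := by
    have h := hu 1 1
    rw [mul_one] at h
    have : u 1 = 0 := by linarith
    simp [this]
  map_mul' γ δ := by rw [hu, ofAdd_add]

/-- Unfolding `cocycleHom`. [folklore] -/
@[simp] theorem cocycleHom_apply (u : Gamma0 N → ℝ)
    (hu : ∀ γ δ : Gamma0 N, u (γ * δ) = u γ + u δ) (γ : Gamma0 N) :
    cocycleHom u hu γ = Multiplicative.ofAdd (u γ) := rfl

variable (N) in
/-- **`H¹_P(Γ₀(N), ℝ)` is finite-dimensional**: a cocycle is a homomorphism, determined by its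
values on a finite generating set of `Γ₀(N)` (finite index in `SL(2, ℤ) = ⟨S, T⟩`, Schreier's
lemma; Mathlib), so `u ↦ (u(γᵢ))ᵢ` is an injective linear map to `ℝᵐ` (Shimura 1971, Prop. 8.3
gives the exact dimension). [folklore] -/
instance finiteDimensional_parabolicCocycles [NeZero N] :
    FiniteDimensional ℝ (parabolicCocycles N) := by
  obtain ⟨S, hS⟩ := Group.fg_def.mp (inferInstance : Group.FG (Gamma0 N))
  let e : parabolicCocycles N →ₗ[ℝ] (S → ℝ) :=
    { toFun := fun u s ↦ (u : Gamma0 N → ℝ) s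
      map_add' := fun _ _ ↦ rfl
      map_smul' := fun _ _ ↦ rfl }
  refine FiniteDimensional.of_injective e fun u v huv ↦ ?_
  apply Subtype.ext
  have key : cocycleHom (u : Gamma0 N → ℝ) u.2.1 = cocycleHom (v : Gamma0 N → ℝ) v.2.1 := by
    refine MonoidHom.eq_of_eqOn_dense hS fun s hs ↦ ?_
    have := congr_fun huv ⟨s, hs⟩
    change Multiplicative.ofAdd ((u : Gamma0 N → ℝ) s) = Multiplicative.ofAdd ((v : Gamma0 N → ℝ) s)
    rw [show (u : Gamma0 N → ℝ) s = (v : Gamma0 N → ℝ) s from this]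
  funext γ
  have := DFunLike.congr_fun key γ
  exact Multiplicative.ofAdd.injective this

end ParabolicCocycles

/-! ### Named fact: Shimura's dimension count `dim_ℝ H¹_P(Γ₀(N), ℝ) = 2 dim_ℂ S₂(Γ₀(N))` -/

section Facts

variable (N : ℕ) [NeZero N]

/-- **Eichler–Shimura, dimension form** (named fact): **`dim_ℝ H¹_P(Γ₀(N), ℝ) = 2 dim_ℂ S₂(Γ₀(N))`**
— Shimura 1971, §8.2, (8.2.23): "The dimension of `H¹_P(Γ, X)` over `ℝ` is twice the dimension of
`S_{n+2}(Γ)` over `ℂ`", for the Fuchsian group of the first kind `Γ = Γ₀(N) ⊆ SL₂(ℝ)`, `n = 0` and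
`Ψ` trivial (so `X = ℝ` with trivial action and `H¹_P(Γ, X)` is `parabolicCocycles N`); it is the
dimension count behind Thm. 8.4 there (`φ : S₂(Γ) → H¹_P(Γ, X)`, `f ↦` class of the real period
cocycle (8.2.19)–(8.2.20), is an `ℝ`-linear isomorphism). Shimura's proof: `dim H¹_P(Γ, X) = 2g`
((8.2.24) with `n = 0`, from Prop. 8.2 and the Euler-characteristic count Prop. 8.3 on a
fundamental domain), `g` the genus of `Γ\ℍ*`, and `dim_ℂ S₂(Γ) = g` (Thm. 2.24, Riemann–Roch).
The inequality `2 dim_ℂ S₂(Γ₀(N)) ≤ dim_ℝ H¹_P(Γ₀(N), ℝ)` (injectivity of `φ`) is the theorem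
`two_mul_finrank_le_finrank_parabolicCocycles` below; the reverse inequality is what is used
(`periodHomology_eq_span_fin_two_mul_finrank_of_parabolicCocycles`). Both sides are genuine
dimensions (`finiteDimensional_parabolicCocycles`, `finiteDimensional_cuspForm_two`). [cite: ShimuraIATAF1971, §8.2 (8.2.23) (case n = 0, Ψ trivial, Γ = Γ₀(N)); Thm. 8.4] -/
def finrank_parabolicCocycles_eq : Prop :=
  Module.finrank ℝ (parabolicCocycles N) = 2 * Module.finrank ℂ (CuspForm (Gamma0 N) 2)

end Facts

/-! ### `rank H₁ ≤ dim H¹_P`: the period homology in a `ℤ`-basis gives independent parabolic cocycles -/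

section Rank

variable (N : ℕ) [NeZero N]

/-- **`H = ℤφ₁ ⊕ ⋯ ⊕ ℤφ_r` with `r ≤ dim_ℝ H¹_P(Γ₀(N), ℝ)`.** The period homology `H ⊆ S₂(Γ₀(N))^∧`
is a finitely generated torsion-free, hence free, abelian group; in a `ℤ`-basis `(φᵢ)` of `H` the
coordinates `γ ↦ coordᵢ(h ↦ {∞, γ∞}_h)` of the period map `Γ₀(N) → H` are parabolic cocycles
(Manin's homomorphism property `periodFunctional_mul` and `periodFunctional_eq_zero_of_isParabolic`),
linearly independent over `ℝ` because the period map is onto `H` (`coe_periodHomology_eq_range`)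
and `coordᵢ(φⱼ) = δᵢⱼ`. This is the homological content of Knapp 1993, Prop. 11.22
(`H₁(X₀(N), ℤ) ≅ Γ₀(N)ᵃᵇ/Γ_epᵃᵇ`, so that `Hom(H, ℝ) ↪ H¹_P(Γ₀(N), ℝ)`). [cite: Knapp1993, Prop. 11.22 with Prop. 11.1] -/
theorem exists_periodHomology_eq_span_card_le :
    ∃ (r : ℕ) (b : Fin r → Module.Dual ℂ (CuspForm (Gamma0 N) 2)),
      (periodHomology N : Set (Module.Dual ℂ (CuspForm (Gamma0 N) 2))) =
          Submodule.span ℤ (Set.range b) ∧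
        r ≤ Module.finrank ℝ (parabolicCocycles N) := by
  classical
  set W := Module.Dual ℂ (CuspForm (Gamma0 N) 2)
  set HZ : Submodule ℤ W := AddSubgroup.toIntSubmodule (periodHomology N) with hHZ
  have hcoe : (HZ : Set W) = (periodHomology N : Set W) := rfl
  -- `HZ` is a finitely generated torsion-free, hence free, `ℤ`-module
  haveI : IsAddTorsionFree W := IsAddTorsionFree.of_isTorsionFree ℂ W
  haveI : Module.Finite ℤ HZ := by
    rw [Module.Finite.iff_fg, Submodule.fg_iff_addSubgroup_fg]
    exact periodHomology_fg
  haveI : Module.Free ℤ HZ := inferInstance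
  let κ := Module.Free.ChooseBasisIndex ℤ HZ
  let β : Module.Basis κ ℤ HZ := Module.Free.chooseBasis ℤ HZ
  -- the period map `ψ : Γ₀(N) → HZ`: a homomorphism, zero on parabolic elements, onto
  let ψ : Gamma0 N → HZ := fun γ ↦ ⟨periodFunctional N γ, periodFunctional_mem_periodHomology N γ⟩
  have hψ_mul : ∀ γ δ, ψ (γ * δ) = ψ γ + ψ δ := fun γ δ ↦ by
    apply Subtype.ext
    simp [ψ, periodFunctional_mul]
  have hψ_par : ∀ γ : Gamma0 N, ((γ : SL(2, ℤ)) : Matrix (Fin 2) (Fin 2) ℤ).IsParabolic →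
      ψ γ = 0 := fun γ hγ ↦ by
    apply Subtype.ext
    simp [ψ, periodFunctional_eq_zero_of_isParabolic hγ]
  have hψ_surj : ∀ x : HZ, ∃ γ, ψ γ = x := by
    rintro ⟨x, hx⟩
    have hx' : x ∈ (periodHomology N : Set W) := hx
    rw [coe_periodHomology_eq_range] at hx'
    obtain ⟨γ, rfl⟩ := hx'
    exact ⟨γ, rfl⟩
  -- the coordinate cocycles `χᵢ = coordᵢ ∘ ψ` are linearly independent parabolic cocycles
  let χ : κ → Gamma0 N → ℝ := fun i γ ↦ ((β.coord i (ψ γ) : ℤ) : ℝ)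
  have hχ : ∀ i, χ i ∈ parabolicCocycles N := fun i ↦ by
    refine ⟨fun γ δ ↦ ?_, fun γ hγ ↦ ?_⟩
    · simp only [χ, hψ_mul, map_add, Int.cast_add]
    · simp only [χ, hψ_par γ hγ, map_zero, Int.cast_zero]
  let v : κ → parabolicCocycles N := fun i ↦ ⟨χ i, hχ i⟩
  have hv : LinearIndependent ℝ v := by
    rw [Fintype.linearIndependent_iff]
    intro c hc j
    obtain ⟨γ, hγ⟩ := hψ_surj (β j)
    have h1 := congr_fun (congrArg Subtype.val hc) γ
    simp only [Submodule.coe_sum, Submodule.coe_smul, Finset.sum_apply, Pi.smul_apply,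
      smul_eq_mul, Submodule.coe_zero, Pi.zero_apply, v, χ, hγ, Module.Basis.coord_apply,
      Module.Basis.repr_self] at h1
    simpa [Finsupp.single_apply] using h1
  have hcard : Fintype.card κ ≤ Module.finrank ℝ (parabolicCocycles N) :=
    hv.fintype_card_le_finrank
  -- `HZ` is the `ℤ`-span of the basis vectors
  let b : κ → W := fun i ↦ (β i : W)
  have hHZb : HZ = Submodule.span ℤ (Set.range b) := by
    have h := congrArg (Submodule.map HZ.subtype) β.span_eq
    rw [Submodule.map_span, Submodule.map_subtype_top, ← Set.range_comp] at h
    exact h.symm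
  refine ⟨Fintype.card κ, b ∘ (Fintype.equivFin κ).symm, ?_, hcard⟩
  rw [(Fintype.equivFin κ).symm.surjective.range_comp, ← hHZb, hcoe]

/-- **`2 dim_ℂ S₂(Γ₀(N)) ≤ dim_ℝ H¹_P(Γ₀(N), ℝ)`** (proved; the injectivity half of the
Eichler–Shimura isomorphism `S₂(Γ₀(N)) ≅ H¹_P(Γ₀(N), ℝ)`, Shimura 1971, Thm. 8.4, in dimension
form): the period homology `H` spans the `2 dim_ℂ S₂`-dimensional real space `S₂(Γ₀(N))^∧`
(`periodHomology_span_eq_top`), so `2 dim_ℂ S₂ ≤ rank H`, and `rank H ≤ dim H¹_P`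
(`exists_periodHomology_eq_span_card_le`). [cite: ShimuraIATAF1971, Thm. 8.4 (injectivity of φ)] -/
theorem two_mul_finrank_le_finrank_parabolicCocycles :
    2 * Module.finrank ℂ (CuspForm (Gamma0 N) 2) ≤ Module.finrank ℝ (parabolicCocycles N) := by
  obtain ⟨r, b, hb, hr⟩ := exists_periodHomology_eq_span_card_le N
  have hspan : Submodule.span ℝ (Set.range b) = ⊤ := by
    rw [← periodHomology_span_eq_top N, hb, Submodule.span_span_of_tower]
  have hW : Module.finrank ℝ (Module.Dual ℂ (CuspForm (Gamma0 N) 2)) =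
      2 * Module.finrank ℂ (CuspForm (Gamma0 N) 2) := by
    rw [finrank_real_of_complex, Subspace.dual_finrank_eq]
  have h1 : Module.finrank ℝ (Module.Dual ℂ (CuspForm (Gamma0 N) 2)) ≤ r := by
    have h := finrank_range_le_card (R := ℝ) b
    rw [Set.finrank, hspan, finrank_top, Fintype.card_fin] at h
    exact h
  omega

/-- **Shimura's (8.2.23) implies `rank H₁ ≤ 2 dim S₂`**: if
`dim_ℝ H¹_P(Γ₀(N), ℝ) = 2 dim_ℂ S₂(Γ₀(N))` (`finrank_parabolicCocycles_eq`), then the period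
homology is generated by `2 dim_ℂ S₂(Γ₀(N))` elements (`periodHomology_eq_span_fin_two_mul_finrank`
of `ModularSymbolsPeriodHomology`): by `exists_periodHomology_eq_span_card_le` it is
`ℤφ₁ ⊕ ⋯ ⊕ ℤφ_r` with `r ≤ dim H¹_P = 2 dim S₂`; pad the generating family by zeros
(Shimura 1971, §8.2; Knapp 1993, Prop. 11.22, (11.37): `H₁(X₀(N), ℤ) ≅ ℤ^{2g}`). [cite: ShimuraIATAF1971, §8.2 (8.2.23)] -/
theorem periodHomology_eq_span_fin_two_mul_finrank_of_parabolicCocycles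
    (H : finrank_parabolicCocycles_eq N) : periodHomology_eq_span_fin_two_mul_finrank N := by
  classical
  obtain ⟨r, b, hb, hr⟩ := exists_periodHomology_eq_span_card_le N
  have hr' : r ≤ 2 * Module.finrank ℂ (CuspForm (Gamma0 N) 2) := H ▸ hr
  -- pad the family `b` by zeros to a family indexed by `Fin (2 dim S₂)`
  obtain ⟨e⟩ : Nonempty (Fin r ↪ Fin (2 * Module.finrank ℂ (CuspForm (Gamma0 N) 2))) :=
    Function.Embedding.nonempty_of_card_le (by simpa using hr')
  refine ⟨Function.extend e b 0, ?_⟩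
  rw [hb]
  congr 1
  apply le_antisymm
  · rw [Submodule.span_le]
    rintro _ ⟨i, rfl⟩
    refine Submodule.subset_span ⟨e i, ?_⟩
    exact e.injective.extend_apply _ _ _
  · rw [Submodule.span_le]
    rintro _ ⟨j, rfl⟩
    by_cases hj : ∃ i, e i = j
    · obtain ⟨i, rfl⟩ := hj
      rw [e.injective.extend_apply]
      exact Submodule.subset_span ⟨i, rfl⟩
    · rw [Function.extend_apply' _ _ _ hj, Pi.zero_apply]
      exact zero_mem _

/-- **The Eichler–Shimura lattice property from Shimura's dimension count (8.2.23)**: if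
`dim_ℝ H¹_P(Γ₀(N), ℝ) = 2 dim_ℂ S₂(Γ₀(N))`, then for every normalised newform `f ∈ S₂(Γ₀(N))` with
rational coefficients the period lattice `Λ_f` is a lattice in `ℂ` (`isZLattice_periodLattice` of
`ModularSymbols`; Shimura 1971, Thm. 7.14; Knapp 1993, Thm. 11.74(d)), via
`periodHomology_eq_span_fin_two_mul_finrank_of_parabolicCocycles`, `periodHomology_eq_span_basis_of`
and `isZLattice_periodLattice_of_periodHomology` (Hecke stability of the period homology and
multiplicity one, `ModularSymbolsPeriodHomology`). [cite: ShimuraIATAF1971, Thm. 7.14 with §8.2 (8.2.23)] -/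
theorem isZLattice_periodLattice_of_parabolicCocycles (H : finrank_parabolicCocycles_eq N)
    {f : CuspForm (Gamma0 N) 2} : isZLattice_periodLattice (f := f) :=
  isZLattice_periodLattice_of_periodHomology
    (periodHomology_eq_span_basis_of N
      (periodHomology_eq_span_fin_two_mul_finrank_of_parabolicCocycles N H))

/-- **`Ω⁺_f > 0` from Shimura's (8.2.23) and conjugation-stability** (Cremona 1997, §2.8;
`IsNewform0.plusPeriod_pos_of`). [cite: CremonaAlgorithms1997, §2.8] -/
theorem IsNewform0.plusPeriod_pos_of_parabolicCocycles (H : finrank_parabolicCocycles_eq N)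
    {f : CuspForm (Gamma0 N) 2} (H₂ : conj_mem_periodLattice (f := f)) :
    IsNewform0.plusPeriod_pos (f := f) :=
  IsNewform0.plusPeriod_pos_of (isZLattice_periodLattice_of_parabolicCocycles N H) H₂

/-- **`Ω⁻_f > 0` from Shimura's (8.2.23) and conjugation-stability** (Cremona 1997, §2.8;
`IsNewform0.minusPeriod_pos_of`). [cite: CremonaAlgorithms1997, §2.8] -/
theorem IsNewform0.minusPeriod_pos_of_parabolicCocycles (H : finrank_parabolicCocycles_eq N)
    {f : CuspForm (Gamma0 N) 2} (H₂ : conj_mem_periodLattice (f := f)) :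
    IsNewform0.minusPeriod_pos (f := f) :=
  IsNewform0.minusPeriod_pos_of (isZLattice_periodLattice_of_parabolicCocycles N H) H₂

end Rank

end Literature.NumberTheory.EllipticCurves.ModularForms
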